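import Summits.BirchSwinnertonDyer.BirchSwinnertonDyer.Theorems.ByReductionTypeAtTwoSupersingularFlatKernelClosed
import Mathlib.Algebra.Module.CharacterModule
import Mathlib.Algebra.BigOperators.Field
import Mathlib.Algebra.BigOperators.Pi
import Mathlib.Algebra.GroupWithZero.Action.Pi
import Mathlib.Topology.Instances.AddCircle.Defs
import HarnessLib

/-!
# `Ker Col♭` equals its double annihilator under the local Tate pairing: `K^⊥⊥ = K` in
# `𝓗 = Hom(E(K_∞·K_v), ℤ_p)` (Pontryagin biduality for the pair `E(K_∞·K_v) ⊗ ℚ_p/ℤ_p`, `𝓗`) — the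
# `p = 2` port of the ♭-local lift LOC♭, part 17

Seat `bsd-2adic-ss-1` GEN 13, crux `SupersingularRankZeroAtTwo` (item stmt-BirchSwinnertonDyer-19097, route
`ByReductionTypeAtTwo`, rung K4), line `flat_uniform_two` v1, stub (2) `stub_allFlatData`, conjunct COUNT♭@2,
displayed input `hloc2` (LOC♭) of the door `SSFlatEC.flatCountTwo_of_print_of_loc2` (part 15). Sequel of part 16
(`…FlatKernelClosed.lean`: `Ker Col♭` is twist-saturated and CLOSED in the finite topology).

Under the transcription convention of `Sprung2012/ColemanMaps.lean` the local Tate pairing of `z ∈ H¹_Iw(T) =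
𝓗 := Hom(M, ℤ_p)`, `M = E(K_∞·K_v)`, with the Kummer class of `x ⊗ p^{-k}` is `z(x)/p^k mod ℤ_p`, so Sprung's
`E♭_{∞,𝔭}` = "exact annihilator of `Ker Col♭`" (Def. 7.9) is the set of `(x, k)` with `p^k ∣ z(x)` for all
`z ∈ K := Ker Col♭`, and ITS annihilator in `𝓗` is
`K^⊥⊥ = {z | ∀ x k, (∀ z' ∈ K, p^k ∣ z'(x)) → p^k ∣ z(x)}`. THIS FILE proves **`K^⊥⊥ = K`**
(`mem_colemanKer_flat_of_forall_annihilator_dvd`): a `z ∈ K^⊥⊥` agrees with SOME `z' ∈ K` modulo `p^k` on any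
finite set (§1, `exists_mem_forall_dvd_sub_of_forall_comb_dvd`: in the finite group `(ℤ/p^k)^F` a point outside
the image of `K` is separated from it by a character — `ℚ/ℤ` is an injective cogenerator, Mathlib
`CharacterModule.exists_character_apply_ne_zero_of_ne_zero` — and every character of `(ℤ/p^k)^F` is
`a ↦ Σ nᵢaᵢ/p^k`, i.e. the pairing with `x = Σ nᵢxᵢ`), hence lies in the CLOSURE of `K`, which is `K` (part 16).
Consequence (parts 18+): the twist-saturation of `K` (part 16 §1) transfers to `K^⊥⊥`, which is the
Pontryagin-dual form of «`(E♭_∞)_Γ = 0`» = LOC♭ modulo `cd_p Γ = 1`.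
Hypotheses: `p ∣ a_p`, a local `g` restricting to a topological generator, levels `c_n ∈ E(K_n·K_v)`, the
`n ≥ 1` trace relation; any number field, any completion, any `p`.
HONEST FRAMING: kernel algebra on the tree's transcription; nothing about any curve is asserted; no census cell
moves; BSD is not proved by any of this.

References: [Sprung2012] Def. 7.9, Lemma 7.10, Def. 7.11 (p. 1503), Prop. 5.7 (p. 1495);
[NeukirchSchmidtWingberg2008] I §1 (1.1.8) (Pontryagin duality: characters separate points from closed
subgroups); [Sprung2024] §5.2 p. 40 ("Taking Pontryagin duals").
-/

set_option autoImplicit false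
-- the Theorems namespace of this sub repeats the summit name by design (D-0017 nested layout)
set_option linter.dupNamespace false

noncomputable section

open scoped Classical NumberField

open NumberField IsDedekindDomain Polynomial WeierstrassCurve Literature.NumberTheory.EllipticCurves
  Literature.NumberTheory.GaloisRepresentations Literature.NumberTheory.EllipticCurves.ZpExtension
  Literature.NumberTheory.EllipticCurves.Kobayashi2003 Literature.NumberTheory.EllipticCurves.Sprung2017
  Literature.NumberTheory.EllipticCurves.Sprung2012

universe u

namespace Summit.BirchSwinnertonDyer.BirchSwinnertonDyer.Theorems.SSFlatEC

/-! ## §1 Finite-level duality: a functional in the double annihilator of `K` is `p^k`-close to `K` on any finite set -/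

section Finite

variable {N : Type*} [AddCommGroup N] {p : ℕ} [hp : Fact p.Prime]

/-- An element of `ℚ/ℤ = AddCircle (1 : ℚ)` killed by `p^k` is the class of `a / p^k` for an integer `a`.
[folklore] -/
private theorem exists_eq_coe_int_div_of_nsmul_eq_zero' {k : ℕ} {u : AddCircle (1 : ℚ)}
    (hu : p ^ k • u = 0) : ∃ a : ℤ, u = (((a : ℚ) / (p : ℚ) ^ k : ℚ) : AddCircle (1 : ℚ)) := by
  induction u using QuotientAddGroup.induction_on with
  | H q =>
    change p ^ k • ((q : ℚ) : AddCircle (1 : ℚ)) = 0 at hu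
    rw [← AddCircle.coe_nsmul, AddCircle.coe_eq_zero_iff] at hu
    obtain ⟨a, ha⟩ := hu
    refine ⟨a, ?_⟩
    change ((q : ℚ) : AddCircle (1 : ℚ)) = _
    congr 1
    have hpm : ((p : ℚ) ^ k) ≠ 0 := pow_ne_zero _ (Nat.cast_ne_zero.mpr hp.out.ne_zero)
    rw [eq_div_iff hpm]
    rw [zsmul_eq_mul, mul_one, nsmul_eq_mul, Nat.cast_pow] at ha
    rw [mul_comm]
    exact ha.symm

/-- The class of `a / p^k` in `ℚ/ℤ` vanishes iff `p^k ∣ a`. [folklore] -/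
private theorem coe_int_div_eq_zero_iff {k : ℕ} (a : ℤ) :
    ((((a : ℚ) / (p : ℚ) ^ k : ℚ) : AddCircle (1 : ℚ)) = 0) ↔ ((p : ℤ) ^ k ∣ a) := by
  have hpm : ((p : ℚ) ^ k) ≠ 0 := pow_ne_zero _ (Nat.cast_ne_zero.mpr hp.out.ne_zero)
  rw [AddCircle.coe_eq_zero_iff]
  constructor
  · rintro ⟨n, hn⟩
    rw [zsmul_eq_mul, mul_one, eq_div_iff hpm] at hn
    refine ⟨n, ?_⟩
    have h' : (((p : ℤ) ^ k * n : ℤ) : ℚ) = (a : ℚ) := by push_cast; rw [mul_comm]; exact hn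
    exact (Int.cast_injective h').symm
  · rintro ⟨n, rfl⟩
    refine ⟨n, ?_⟩
    rw [zsmul_eq_mul, mul_one, eq_div_iff hpm]
    push_cast
    ring

/-- `p^k ∣ a` in `ℤ_p` iff the reduction of `a` modulo `p^k` vanishes. [folklore] -/
private theorem pow_dvd_iff_toZModPow_eq_zero {k : ℕ} (a : ℤ_[p]) :
    (p : ℤ_[p]) ^ k ∣ a ↔ PadicInt.toZModPow k a = 0 := by
  rw [← RingHom.mem_ker, PadicInt.ker_toZModPow, Ideal.mem_span_singleton]

/-- **Finite-level Pontryagin duality for `ℤ_p`-valued functionals.** Let `K` be a subgroup of `Hom(N, ℤ_p)`,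
`x : ι → N` a finite family and `z` a functional such that, for every integer combination `y = Σ nᵢxᵢ`,
«`p^k ∣ z'(y)` for all `z' ∈ K`» implies «`p^k ∣ z(y)`» (i.e. `z` lies in the double annihilator of `K` for the
pairing `z(y)/p^k`). Then some `z' ∈ K` agrees with `z` modulo `p^k` on every `xᵢ`. Proof: otherwise the image
of `z` in `(ℤ/p^k)^ι` lies outside the image of `K`; a character `χ` of the (finite) quotient separates them
(`ℚ/ℤ` is an injective cogenerator); every character of `(ℤ/p^k)^ι` is `a ↦ Σ aᵢnᵢ/p^k`, i.e. `w ↦ w(Σ nᵢxᵢ)/p^k`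
— which kills `K` but not `z`, contradicting the hypothesis at `y = Σ nᵢxᵢ`.
[cite: NeukirchSchmidtWingberg2008, I §1 (1.1.8) (Pontryagin duality)] -/
theorem exists_mem_forall_dvd_sub_of_forall_comb_dvd (K : AddSubgroup (N →+ ℤ_[p])) {ι : Type*}
    [Fintype ι] (x : ι → N) (k : ℕ) (z : N →+ ℤ_[p])
    (hz : ∀ n : ι → ℤ, (∀ z' ∈ K, (p : ℤ_[p]) ^ k ∣ z' (∑ i, n i • x i)) →
      (p : ℤ_[p]) ^ k ∣ z (∑ i, n i • x i)) :
    ∃ z' ∈ K, ∀ i, (p : ℤ_[p]) ^ k ∣ z (x i) - z' (x i) := by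
  by_contra hcon
  push Not at hcon
  -- the reduction map `ρ : Hom(N, ℤ_p) → (ℤ/p^k)^ι`
  let ρ : (N →+ ℤ_[p]) →+ (ι → ZMod (p ^ k)) :=
    { toFun := fun w i ↦ PadicInt.toZModPow k (w (x i))
      map_zero' := by ext i; simp
      map_add' := fun a b ↦ by ext i; simp }
  have hρ : ∀ (w : N →+ ℤ_[p]) (i : ι), ρ w i = PadicInt.toZModPow k (w (x i)) := fun _ _ ↦ rfl
  let S : AddSubgroup (ι → ZMod (p ^ k)) := K.map ρ
  -- `ρ z ∉ S`
  have hne : (QuotientAddGroup.mk (ρ z) : (ι → ZMod (p ^ k)) ⧸ S) ≠ 0 := by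
    intro h
    rw [QuotientAddGroup.eq_zero_iff] at h
    obtain ⟨z', hz'K, hρz'⟩ := AddSubgroup.mem_map.mp h
    obtain ⟨i, hi⟩ := hcon z' hz'K
    apply hi
    rw [pow_dvd_iff_toZModPow_eq_zero, map_sub, sub_eq_zero, ← hρ, ← hρ, hρz']
  -- a character of the quotient separating `ρ z` from `S`
  obtain ⟨χ, hχ⟩ := CharacterModule.exists_character_apply_ne_zero_of_ne_zero hne
  let χ₀ : (ι → ZMod (p ^ k)) →+ AddCircle (1 : ℚ) :=
    (χ : ((ι → ZMod (p ^ k)) ⧸ S) →+ AddCircle (1 : ℚ)).comp (QuotientAddGroup.mk' S)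
  have hχ₀z : χ₀ (ρ z) ≠ 0 := hχ
  have hχ₀S : ∀ z' ∈ K, χ₀ (ρ z') = 0 := by
    intro z' hz'
    change (χ : ((ι → ZMod (p ^ k)) ⧸ S) →+ AddCircle (1 : ℚ)) (QuotientAddGroup.mk' S (ρ z')) = 0
    rw [QuotientAddGroup.mk'_apply, (QuotientAddGroup.eq_zero_iff _).mpr (AddSubgroup.mem_map_of_mem ρ hz'),
      map_zero]
  -- every character of `(ℤ/p^k)^ι` is `a ↦ Σ aᵢ nᵢ / p^k`
  have ht : ∀ i, ∃ n : ℤ, χ₀ (Pi.single i 1) = (((n : ℚ) / (p : ℚ) ^ k : ℚ) : AddCircle (1 : ℚ)) := by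
    intro i
    apply exists_eq_coe_int_div_of_nsmul_eq_zero'
    rw [← map_nsmul, ← Pi.single_smul', nsmul_one, ZMod.natCast_self, Pi.single_zero, map_zero]
  choose n hn using ht
  -- the test element `y = Σ nᵢ xᵢ`
  set y : N := ∑ i, n i • x i with hy
  -- the value of `χ₀ ∘ ρ` and the reduction of `w(y)` are governed by the same integer `Σ nᵢ vᵢ(w)`
  have hval : ∀ w : N →+ ℤ_[p], χ₀ (ρ w) =
      ((((∑ i, ((PadicInt.toZModPow k (w (x i))).val : ℤ) * n i : ℤ) : ℚ) / (p : ℚ) ^ k : ℚ) :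
        AddCircle (1 : ℚ)) := by
    intro w
    have hsingle : ∀ (i : ι) (a : ZMod (p ^ k)),
        Pi.single (M := fun _ ↦ ZMod (p ^ k)) i a = a.val • Pi.single (M := fun _ ↦ ZMod (p ^ k)) i 1 := by
      intro i a
      conv_lhs => rw [← ZMod.natCast_zmod_val a]
      rw [← nsmul_one, Pi.single_smul']
    have hdec : ρ w = ∑ i, ((PadicInt.toZModPow k (w (x i))).val : ℕ) •
        Pi.single (M := fun _ ↦ ZMod (p ^ k)) i (1 : ZMod (p ^ k)) := by
      conv_lhs => rw [← Finset.univ_sum_single (ρ w)]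
      exact Finset.sum_congr rfl fun i _ ↦ hsingle i (ρ w i)
    have hterm : ∀ (m : ℕ) (c : ℤ), m • ((((c : ℚ) / (p : ℚ) ^ k : ℚ)) : AddCircle (1 : ℚ)) =
        ((((m * c : ℤ) : ℚ) / (p : ℚ) ^ k : ℚ) : AddCircle (1 : ℚ)) := by
      intro m c
      rw [← AddCircle.coe_nsmul]
      congr 1
      push_cast
      ring
    rw [hdec, map_sum]
    simp_rw [map_nsmul, hn, hterm]
    rw [Int.cast_sum, Finset.sum_div]
    exact (map_sum (QuotientAddGroup.mk' (AddSubgroup.zmultiples (1 : ℚ))) _ _).symm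
  have hred : ∀ w : N →+ ℤ_[p], PadicInt.toZModPow k (w y) =
      ((∑ i, ((PadicInt.toZModPow k (w (x i))).val : ℤ) * n i : ℤ) : ZMod (p ^ k)) := by
    intro w
    rw [hy, map_sum, map_sum, Int.cast_sum]
    refine Finset.sum_congr rfl fun i _ ↦ ?_
    rw [map_zsmul, map_zsmul, Int.cast_mul, Int.cast_natCast, ZMod.natCast_zmod_val, zsmul_eq_mul, mul_comm]
  have hiff : ∀ w : N →+ ℤ_[p], χ₀ (ρ w) = 0 ↔ (p : ℤ_[p]) ^ k ∣ w y := by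
    intro w
    rw [hval, coe_int_div_eq_zero_iff, pow_dvd_iff_toZModPow_eq_zero, hred,
      ZMod.intCast_zmod_eq_zero_iff_dvd, Nat.cast_pow]
  -- contradiction
  have hKy : ∀ z' ∈ K, (p : ℤ_[p]) ^ k ∣ z' y := fun z' hz' ↦ (hiff z').mp (hχ₀S z' hz')
  exact hχ₀z ((hiff z).mpr (hz n hKy))

end Finite

/-! ## §2 `K^⊥⊥ = K` for `K = Ker Col♭` -/

variable {K : Type u} [Field K] {p : ℕ} [Fact p.Prime] (κ : ZpExtension K p)
variable {E : Type u} [Field E] [Algebra K E] (ι : AlgebraicClosure K →ₐ[K] AlgebraicClosure E)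
variable (W : WeierstrassCurve K)

/-- **`(Ker Col♭)^⊥⊥ = Ker Col♭`.** A functional `z` on `M = E(K_∞·K_v)` such that `p^k ∣ z(x)` whenever
`p^k ∣ z'(x)` for all `z' ∈ Ker Col♭` (i.e. `z` annihilates the ♭-local condition `E♭_{∞,𝔭}` = the exact
annihilator of `Ker Col♭`, Def. 7.9) lies in `Ker Col♭`: by §1 it is `p^k`-close to `Ker Col♭` on the finite
sets `{gʲ c_m : m ∈ {n, n+1}}`, and `Ker Col♭` is closed (part 16).
[cite: Sprung2012, Def. 7.9 and Lemma 7.10 (p. 1503), Prop. 5.7 (p. 1495)]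
[cite: NeukirchSchmidtWingberg2008, I §1 (1.1.8) (Pontryagin duality)] -/
theorem mem_colemanKer_flat_of_forall_annihilator_dvd {ap : ℤ} (hap : (p : ℤ) ∣ ap)
    {g : Field.absoluteGaloisGroup E} (hg : κ.IsTopGenerator (resGalOfEmb ι g))
    {c : ℕ → localPoints W E} (hc : ∀ n, c n ∈ localLayerPointsOfEmb κ ι W n)
    (hTr : ∀ n, 1 ≤ n → localTraceOfEmb κ ι W n (n + 1) (c (n + 1)) = ap • c n - c (n - 1))
    (z : localTowerPointsOfEmb κ ι W →+ ℤ_[p])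
    (hz : ∀ (x : localTowerPointsOfEmb κ ι W) (k : ℕ),
      (∀ z' ∈ colemanKer κ ι W ap g c .flat, (p : ℤ_[p]) ^ k ∣ z' x) → (p : ℤ_[p]) ^ k ∣ z x) :
    z ∈ colemanKer κ ι W ap g c .flat := by
  -- `Ker Col♭` as an additive subgroup of `Hom(M, ℤ_p)`
  let Kf : AddSubgroup (localTowerPointsOfEmb κ ι W →+ ℤ_[p]) :=
    { carrier := colemanKer κ ι W ap g c .flat
      zero_mem' := zero_mem_colemanKer κ ι W ap g c .flat
      add_mem' := by
        rintro a b ⟨La, Ma, ha, ha0⟩ ⟨Lb, Mb, hb, hb0⟩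
        rw [chromaticL_flat] at ha0 hb0
        exact ⟨La + Lb, Ma + Mb, ha.add hb, by rw [chromaticL_flat, ha0, hb0, add_zero]⟩
      neg_mem' := by
        rintro a ⟨La, Ma, ha, ha0⟩
        rw [chromaticL_flat] at ha0
        refine ⟨0 - La, 0 - Ma, ?_, by rw [chromaticL_flat, ha0, sub_zero]⟩
        have h := (isColemanPair_zero κ ι W ap g c).sub ha
        rwa [zero_sub] at h }
  have hKf : ∀ w, w ∈ Kf ↔ w ∈ colemanKer κ ι W ap g c .flat := fun _ ↦ Iff.rfl
  have hmem : ∀ (m j : ℕ), g ^ j • c m ∈ localTowerPointsOfEmb κ ι W := fun m j ↦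
    smul_mem_localTowerPointsOfEmb κ ι W _ (localLayerPointsOfEmb_le_localTowerPointsOfEmb κ ι W m (hc m))
  refine mem_colemanKer_flat_of_forall_exists_agree κ ι W hap hg hc hTr z fun n k ↦ ?_
  -- the finite test family `(b, j) ↦ gʲ c_{n+b}`, `j < p^{n+1}`
  let x : Bool × Fin (p ^ (n + 1)) → localTowerPointsOfEmb κ ι W := fun bj ↦
    ⟨g ^ (bj.2 : ℕ) • c (if bj.1 then n + 1 else n), hmem _ _⟩
  obtain ⟨z', hz'K, hz'⟩ := exists_mem_forall_dvd_sub_of_forall_comb_dvd Kf x k z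
    (fun nv hK ↦ hz _ k fun w hw ↦ hK w ((hKf w).mpr hw))
  refine ⟨z', (hKf z').mp hz'K, fun m hm j hj ↦ ?_⟩
  have hjlt : j < p ^ (n + 1) := by
    rcases hm with rfl | rfl
    · exact lt_of_lt_of_le hj (Nat.pow_le_pow_right (Fact.out : p.Prime).pos (Nat.le_succ _))
    · exact hj
  rw [evalOn_of_mem W _ z (hmem m j), evalOn_of_mem W _ z' (hmem m j)]
  rcases hm with rfl | rfl
  · exact hz' (false, ⟨j, hjlt⟩)
  · exact hz' (true, ⟨j, hjlt⟩)

end Summit.BirchSwinnertonDyer.BirchSwinnertonDyer.Theorems.SSFlatEC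

end
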